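import Literature.MathematicalPhysics.QuantumFieldTheory.Balaban1983to89.B9PinMembersKLevelV1
import Literature.MathematicalPhysics.QuantumFieldTheory.Balaban1983to89.Node00.MemberYRefineDomains

/-!
# `Balaban1983to89.Node00.MemberYRefine` — THE n-FOLD REFINEMENT `x ↦ x⁺` OF A MEMBER OF THE [B9] FAMILY INDEX (MODULE B, the V1-chart layer over
# `Node00.MemberYRefineDomains`): `refineK : KIdx → KIdx`, `refineY : MemberY → MemberY` (`K ↦ K + n`, `k ↦ k + n`, `c_f ↦ Lⁿc_f`, `{Ω_j} ↦ {Ω_j}`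
# refined, weights transported through the index-bond bijection), the site embedding `ιY` of the geometries of record with `scale_ιY = + n` and
# `dist_ιY` AN EQUALITY, `eta_refineY : η⁺·Lⁿ = η` — the type-level fields of the η-pairing `T4EtaRate.EtaPairing (geo9Y x) (geo9Y x⁺)` — and a
# CANDIDATE argument transport `τPull` (the pullback along `x′ ↦ x`) with its two bookkeeping axioms

[4] = T. Bałaban, *Propagators and renormalization transformations for lattice gauge theories. II*, Commun. Math. Phys. **96** (1984) 223–250
[`Balaban1984PropagatorsII`]; [3] = part I, Commun. Math. Phys. **95** (1984) 17–40 [`Balaban1984PropagatorsI`]; [B9] = T. Bałaban, *Propagators for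
lattice gauge theories in a background field*, Commun. Math. Phys. **99** (1985) 389–434 [`Balaban1985BackgroundPropagators`]; [K] = C. King, *The U(1)
Higgs model. I. The continuum limit*, Commun. Math. Phys. **102** (1986) 649–677 [`King1986`].

statement-level skeleton of published theorems with citation tags; proofs where landed; nothing here is a claim about the
Yang–Mills mass gap

THE PRINTED LOCI.  [K] p. 664 (the convention before Prop. 3.8): two runs, A at spacing `η = L⁻ᵏ` and B at `η′ = L⁻ⁿη` (`k + n` scales), compared
site by site — «when x′ ∈ T_{η′}, we denote by x that point in T_η for which x′ ∈ Bⁿ(x)»; a site of `Λ_j` in run A is the site of scale index `j + n`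
and the same physical size in run B.  [4] (2.1)–(2.4) p. 224 (the nested sequence `{Ω_j}`, the index sets `Λ_j` of sites AND bonds), (2.14) p. 225 (the
band of the weights `a_j(Lʲη)^{d−2}`), (2.45)–(2.46) p. 231 (`𝔅`, `d(y, y′)`).  [B9] p. 399: the family index is `(torus, k, {Ω_j}, M)` at fixed
`d, L`; Thm 3.14 pp. 426–427 (two sequences), Thm 3.15 (3.185)–(3.187) p. 432 (the Sect.-E datum `Λ`).  THE REFINED MEMBER `x⁺`: run B's datum — cut-off
`K + n` (the torus `T_{η′}`, `Lⁿ` times more sites per direction, the same physical box `2L^m`), `k + n` levels, `Ω⁺_{j+n} := Ω_j` read on `T_{η′}`,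
`Ω⁺_1 = … = Ω⁺_{n+1} = T_{η′}`, `c_f⁺ = Lⁿc_f` (`η⁺ = L⁻ⁿη`), the SAME `M_h, R, a, P′`, the (2.14)-banded weights transported bond by bond (the same
physical `a_j`), `Λ⁺ := {x′ | x ∈ Λ}`.  It IS a member of the printed family (index bookkeeping «as printed»; no estimate).

WHY THIS FILE (cell `pub-ymgap`, seat `pub-ymgap-node00-def-Y` gen 19 = the OWNER of the `OpsY` instance at the record — `MemberY` is this lineage's
MODULE 3 over r03's `KIdx`; dag-n15-a g19 LOCATED-R ∕ (t5a): the N15 knit `NE2Objects₁₁` indexes its one-step objects by `Σ (x : MemberY …), {n // 1 ≤ n}`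
with `pi ⟨x, n⟩ := ⟨geo9Y x, geo9Y x⁺, …, pairingY x n⟩`, and RR-1 §2's `pairingOfRecord₁₁ : T4EtaRate.EtaPairing (geo9Y x) (geo9Y x⁺) …` needs AT THE TYPE
LEVEL `n`, `k_eq`, `L_eq`, `M_eq`, `eta_eq`, a site embedding `ι` with `scale_ι = + n` and `dist_ι` — here an EQUALITY).  MODULE A
(`Node00.MemberYRefineDomains`, the torus-family layer: `refineT`, the block embedding `ιB` = a graph ISOMORPHISM of the (2.46) bonds, `geomT_refine_dist`)
is imported; this module is the V1-chart layer over it.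
* §1 THE SITES OF `T_{η′}`: `spd_eq` (`|T⁺^{(j+n)}| = |T^{(j)}|` per direction), `hN_refine` (the fine period `N₀(k + n) = 2L^{m+K+n}`), the LEVEL CASTS
  `siteCast (hi : i = j + n) : T⁺^{(i)} ≃ T^{(j)}` ∕ `bondCast` (coordinatewise `ZMod.ringEquivCongr`, labels kept, commuting with shifts and with the block
  map — the V1-specialised twins of `T4AveragingDisintegration.siteEquiv ∕ bondEquiv`, which sit outside this import closure), [K]'s `x′ ↦ x` =
  `coarsenSite n` (labels `⌊val∕Lⁿ⌋`; `= cast ∘ iterBlockOf n`, surjective) and its two dictionaries ★ `toBox_coarsenSite` (chart: `toBox x = (toBox⁺ x′) ÷ Lⁿ`,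
  MODULE A's `coarsen`) and `iterBlockOf_coarsenSite` (`y^j(x) = cast y^{j+n}(x′)`).
* §2 THE V1 DOMAIN DATA OF RUN B (`domT hN⁺ (refineT D n) hk⁺` against `domT hN D hk`): ★ `mem_Om_refine_iff` — `Ω⁺_i = cast⁻¹ Ω_j` for `i = j + n` at
  EVERY level (the dictionary `Ω_j ↔ {lev ≥ j}` of `B6GlobalChartV1` on both sides + `lev⁺ = lev ∘ (x′ ↦ x) + n`), `mem_Om_refine_low` (`Ω⁺_i = T⁺` for
  `i ≤ n + 1`), `deep_refine_iff`, `lamBond_refine_iff` (`Λ⁺_{j+n} = cast⁻¹ Λ_j` on BONDS), `not_lamBond_refine_low` (`Λ⁺_i = ∅`, `i ≤ n`); hence THE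
  INDEX-BOND BIJECTION ★ `idxUp : 𝔅(D) → 𝔅(D⁺)`, `⟨j, b⟩ ↦ ⟨j + n, cast⁻¹ b⟩` (`idxUp_injective ∕ _surjective`, `idxEquiv`), the TRANSPORTED WEIGHTS
  `wRefine w := L^{n(d+1)}·(w ∘ idxEquiv⁻¹)` and ★ `globalBand_refine`: the band (2.14) holds for `(Lⁿc_f, wRefine w)` with the SAME constants `b₀, b₁`
  (`w⁺∕(c_f⁺∕L^{j+n})² = L^{n(d+1)}·w∕(c_f∕Lʲ)²` — the same physical weight, no loss).
* §3 ★ `refineK : KIdx → KIdx` and ★★ `refineY : MemberY … M⋆ → MemberY … M⋆` (`x ↦ x⁺`): every field of r03's index and of MODULE 3's member transported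
  (`hcfk`: `Lⁿ·Lᵏ = L^{k+n}`, print's units kept; `hpl` by MODULE A's `placed_refineT`; `D′ ↦ refineT D′ n`; `Λ⁺` with `hΛlev ∕ hΛblocks ∕ hΛsep` — the
  separation (3.187) in FINE⁺ units by MODULE A's `sep_of_coarsen`); `mem_Λ_refineY`.
* §4 THE PAIRING FIELDS: `cast_base_idxUp`, ★ `beta_idxUp` (`β⁺(ι c) = ιB(β c)`: the carrier block of the embedded bond is the embedded carrier block),
  ★ `ιY x n : (geo9Y x).Site → (geo9Y x⁺).Site := idxUp` (`ιY_bijective`), `scale_ιY` (`+ n`, `rfl`), ★★ `dist_ιY` — `(geo9Y x⁺).dist (ι c) (ι c′) =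
  (geo9Y x).dist c c′` EXACTLY (MODULE A's `geomT_refine_dist` at the carrier blocks), `k_refineY ∕ L_refineY ∕ M_refineY` (`rfl`), `eta_refineY`
  (`η⁺·Lⁿ = η`), `len_ιY` (`L^{j+n}η⁺ = Lʲη`).
* §5 A CANDIDATE `τ`: `bondCoarsen`, `blkV1_refine` (`y⁺(b′) = ιB(y(b))`), ★ `τPull x n : (geo9Y x).Loc → (geo9Y x⁺).Loc` — [K]'s site convention read on
  the arguments, «λ′(x′) := λ(x)» (torus-site functions pulled back along MODULE A's `coarsen`, fine-bond functions along `bondCoarsen`), with the two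
  bookkeeping axioms of the pairing PROVED: `suppIn_τPull` (`supp λ ⊂ Δ(y) ⟹ supp τλ ⊂ Δ⁺(ιy)`, by `beta_idxUp`) and `supNorm_τPull_le` (`|τλ| ≤ |λ|`).

HONEST SCOPE.  Exactly the fields `n, k_eq, L_eq, M_eq, eta_eq, ι, scale_ι, dist_ι` of `T4EtaRate.EtaPairing (geo9Y x) (geo9Y (refineY x n))` are
supplied, as identities ∕ biconditionals, kernel-checked, plus ONE CANDIDATE for `τ ∕ suppIn_τ ∕ supNorm_τ` (the pullback; whether it is THE transport of
the consumers' `pairingOfRecord₁₁` — RR-1 §2 ∕ dag-n15-a — is their decision: its MEANING is fixed by the unprinted NE2⁺ estimate it serves).  NOT SUPPLIED,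
NOT PRINTED: the background transport `avg` (`avg_one`; the n-fold average of gauge fields is a consumers' `B9.Backgrounds` datum); the η-pairing's
ESTIMATE (NE2⁺ for Bałaban's `G′(U)`) is NOT PRINTED ([K] proves
Prop. 3.8–3.12 for the U(1) Higgs covariances only) and not touched; N15 ∕ N06 NOT discharged; COUNT-NEUTRAL (definition lane).  One finite 𝕋⁴ programme
at fixed ε — nothing continuum, nothing about the mass gap.  Cell `pub-ymgap` (HUMAN RULING D-0062), Track A node N15∕N06, seat `pub-ymgap-node00-def-Y`
(g19), 2026-08-28.

REVISION v1.0.1 (doc-only, zero decl change): header prose `[K]` = King I (CMP **102**, 649–677), and the weight-band locus of [4] is (2.14) p. 225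
(the quadratic form `Σ_j Σ_{y∈Λ_j} a_j(Lʲη)^{−2}|(Q_jλ)(y)|²`; for the vector model «a formula similar to (2.14)», p. 226 after (2.20)) — not (2.16), which is
the extremal system; per ref-E READ-20.
-/

namespace Literature.MathematicalPhysics.QuantumFieldTheory.Balaban1983to89.Node00.MemberYRefine

open Literature.MathematicalPhysics.QuantumFieldTheory.Balaban1983to89.B4Reflection242 (boxDom blk)
open Literature.MathematicalPhysics.QuantumFieldTheory.Balaban1983to89.B4Thm110ZeroBox (blk_blk)
open Literature.MathematicalPhysics.QuantumFieldTheory.Balaban1983to89.B4TorusKernel.MultiPeriod (torusSupNorm)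
open Literature.MathematicalPhysics.QuantumFieldTheory.Balaban1983to89.B6MultiLevelBoxOperator (N0 bigSide)
open Literature.MathematicalPhysics.QuantumFieldTheory.Balaban1983to89.B6MultiLevelTorusOperator (TDomains one_le_of_mem)
open Literature.MathematicalPhysics.QuantumFieldTheory.Balaban1983to89.B6Geom246MultiLevelBox (bset blkOf)
open Literature.MathematicalPhysics.QuantumFieldTheory.Balaban1983to89.B6Geom246MultiLevelTorus (geomT)
open Literature.MathematicalPhysics.QuantumFieldTheory.Balaban1983to89.B6Cover236MultiLevelBlocks (cubes)
open Literature.MathematicalPhysics.QuantumFieldTheory.Balaban1983to89.B6CubeWindowV1 (Placed GlobalBand)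
open Literature.MathematicalPhysics.QuantumFieldTheory.Balaban1983to89.B6GlobalChartV1 (PV toBox toBox_apply domT iterBlockOf_mem_domT_iff)
open Literature.MathematicalPhysics.QuantumFieldTheory.Balaban1983to89.B6SectAOperatorsV1 (BondIdx)
open Literature.MathematicalPhysics.QuantumFieldTheory.Balaban1983to89.B5Eq118OneStroke (iterBlockOf val_iterBlockOf)
open Literature.MathematicalPhysics.QuantumFieldTheory.Balaban1983to89.B6ScalarChartV1 (exists_iterBlockOf_eq)
open Literature.MathematicalPhysics.QuantumFieldTheory.Balaban1983to89.B6Ineq2142KLevelV1 (lvl base baseSite iterBlockOf_baseSite β blkOf_eq_beta)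
open Literature.MathematicalPhysics.QuantumFieldTheory.Balaban1983to89.B6KLevelCensusIndexV1 (KIdx)
open Literature.MathematicalPhysics.QuantumFieldTheory.Balaban1983to89.B9PinMembersKLevelV1 (MemberY geo9Y)
open Literature.MathematicalPhysics.QuantumFieldTheory.Balaban1983to89.Node00.MemberYRefineDomains (N0_add bigSide_add coarsen coarsen_val refineT
  refineT_lev ιB blkOf_refine geomT_refine_dist placed_refineT sep_of_coarsen)

noncomputable section

variable {d ℓ : ℕ} {m K : ℕ} {hd : 1 ≤ d + 1} {hL : Odd (ℓ + 1) ∧ 1 < ℓ + 1}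

/-! ## §1  The sites of the refined V1 torus: the fine period, the level casts `T⁺^{(j+n)} ≃ T^{(j)}`, the coarsening `x′ ↦ x` -/

section Sites

/-- the site counts agree along the refinement: `2·L^{m+(K+n)−i} = 2·L^{m+K−j}` for `i = j + n`. [cite: King1986, p.664 (η′ = L^{−n}η), dictionary] -/
theorem spd_eq {n i j : ℕ} (hi : i = j + n) : (PV d ℓ m (K + n) hd hL).sitesPerDir i = (PV d ℓ m K hd hL).sitesPerDir j := by
  show 2 * (ℓ + 1) ^ (m + (K + n) - i) = 2 * (ℓ + 1) ^ (m + K - j)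
  subst hi
  congr 2
  omega

/-- **THE FINE PERIOD IS THE REFINED V1 TORUS'**: `N₀(k + n) = 2·L^{m+K+n}`. [cite: Balaban1984PropagatorsII, (2.1) p.224; King1986, p.664, dictionary] -/
theorem hN_refine {Mh k : ℕ} {P' : Fin (d + 1) → ℕ} (hN : ∀ μ, N0 ℓ Mh k P' μ = (PV d ℓ m K hd hL).sitesPerDir 0) (n : ℕ) :
    ∀ μ, N0 ℓ Mh (k + n) P' μ = (PV d ℓ m (K + n) hd hL).sitesPerDir 0 := by
  intro μ
  rw [N0_add, hN μ]
  show (ℓ + 1) ^ n * (2 * (ℓ + 1) ^ (m + K - 0)) = 2 * (ℓ + 1) ^ (m + (K + n) - 0)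
  simp only [Nat.sub_zero, pow_add]
  ring

/-- **THE LEVEL CAST `T⁺^{(i)} ≃ T^{(j)}`, `i = j + n`**: the same abstract torus (same site count), coordinatewise `ZMod.ringEquivCongr` — a site of level
`j + n` of the refined run IS a site of level `j` of the run. [cite: King1986, p.664 («scale index j + n … the same physical size»), dictionary] -/
def siteCast {n i j : ℕ} (hi : i = j + n) : Site (PV d ℓ m (K + n) hd hL) i ≃ Site (PV d ℓ m K hd hL) j where
  toFun x μ := ZMod.ringEquivCongr (spd_eq hi) (x μ)
  invFun y μ := (ZMod.ringEquivCongr (spd_eq hi)).symm (y μ)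
  left_inv _ := funext fun _ => RingEquiv.symm_apply_apply _ _
  right_inv _ := funext fun _ => RingEquiv.apply_symm_apply _ _

/-- labels are kept. [cite: King1986, p.664, dictionary] -/
@[simp] theorem val_siteCast {n i j : ℕ} (hi : i = j + n) (x : Site (PV d ℓ m (K + n) hd hL) i) (μ : Fin (d + 1)) :
    ((siteCast hi x) μ).val = (x μ).val :=
  ZMod.ringEquivCongr_val _ _

/-- labels are kept (inverse cast). [cite: King1986, p.664, dictionary] -/
@[simp] theorem val_siteCast_symm {n i j : ℕ} (hi : i = j + n) (y : Site (PV d ℓ m K hd hL) j) (μ : Fin (d + 1)) :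
    (((siteCast hi).symm y) μ).val = (y μ).val := by
  rw [← val_siteCast hi ((siteCast hi).symm y) μ, Equiv.apply_symm_apply]

/-- two sites with the same labels are equal. [folklore] -/
private theorem site_ext {P : Params} {j : ℕ} {x y : Site P j} (h : ∀ μ, (x μ).val = (y μ).val) : x = y :=
  funext fun μ => ZMod.val_injective _ (h μ)

/-- the cast commutes with the lattice shifts. [cite: King1986, p.664, dictionary] -/
theorem siteCast_shift {n i j : ℕ} (hi : i = j + n) (x : Site (PV d ℓ m (K + n) hd hL) i) (μ : Fin (d + 1)) :
    siteCast hi (x.shift μ) = (siteCast hi x).shift μ := by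
  funext ν
  simp only [siteCast, Equiv.coe_fn_mk, Site.shift, Function.update_apply]
  by_cases h : ν = μ
  · subst h
    simp only [if_true, map_add, map_one]
  · simp only [if_neg h]

/-- the cast commutes with the block map. [cite: Balaban1984PropagatorsI, (1.6) p.18; King1986, p.664, dictionary] -/
theorem siteCast_blockOf {n i j : ℕ} (hi : i = j + n) (hj : j + 1 ≤ m + K) (x : Site (PV d ℓ m (K + n) hd hL) i) :
    siteCast (show i + 1 = (j + 1) + n by omega) (blockOf x) = blockOf (siteCast hi x) := by
  apply site_ext
  intro μ
  rw [val_siteCast, Site.val_blockOf (P := PV d ℓ m (K + n) hd hL) (by show i + 1 ≤ m + (K + n); omega),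
    Site.val_blockOf (P := PV d ℓ m K hd hL) (by show j + 1 ≤ m + K; omega), val_siteCast]

/-- **THE BOND CAST** `⟨x, μ⟩ ↦ ⟨cast x, μ⟩`. [cite: King1986, p.664, dictionary] -/
def bondCast {n i j : ℕ} (hi : i = j + n) : PBond (PV d ℓ m (K + n) hd hL) i ≃ PBond (PV d ℓ m K hd hL) j where
  toFun b := ⟨siteCast hi b.src, b.dir⟩
  invFun b := ⟨(siteCast hi).symm b.src, b.dir⟩
  left_inv b := by
    obtain ⟨s, μ⟩ := b
    simp only [Equiv.symm_apply_apply]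
  right_inv b := by
    obtain ⟨s, μ⟩ := b
    simp only [Equiv.apply_symm_apply]

/-- the source of the cast bond. [cite: King1986, p.664, dictionary] -/
@[simp] theorem bondCast_src {n i j : ℕ} (hi : i = j + n) (b : PBond (PV d ℓ m (K + n) hd hL) i) : (bondCast hi b).src = siteCast hi b.src := rfl

/-- the direction of the cast bond. [cite: King1986, p.664, dictionary] -/
@[simp] theorem bondCast_dir {n i j : ℕ} (hi : i = j + n) (b : PBond (PV d ℓ m (K + n) hd hL) i) : (bondCast hi b).dir = b.dir := rfl

/-- the target of the cast bond. [cite: King1986, p.664, dictionary] -/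
theorem bondCast_tgt {n i j : ℕ} (hi : i = j + n) (b : PBond (PV d ℓ m (K + n) hd hL) i) : (bondCast hi b).tgt = siteCast hi b.tgt := by
  show (siteCast hi b.src).shift b.dir = siteCast hi (b.src.shift b.dir)
  rw [siteCast_shift]

/-- the source of the inverse-cast bond. [cite: King1986, p.664, dictionary] -/
@[simp] theorem bondCast_symm_src {n i j : ℕ} (hi : i = j + n) (b : PBond (PV d ℓ m K hd hL) j) :
    ((bondCast hi).symm b).src = (siteCast hi).symm b.src := rfl

/-- **THE COARSENING `x′ ↦ x` OF FINE SITES** («that point in T_η for which x′ ∈ Bⁿ(x)»): labels `⌊val/Lⁿ⌋`. [cite: King1986, p.664 (convention before Prop. 3.8)] -/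
def coarsenSite (n : ℕ) (x : Site (PV d ℓ m (K + n) hd hL) 0) : Site (PV d ℓ m K hd hL) 0 :=
  fun μ => (((x μ).val / (ℓ + 1) ^ n : ℕ) : ZMod ((PV d ℓ m K hd hL).sitesPerDir 0))

/-- the labels of the coarsened site. [cite: King1986, p.664, dictionary] -/
theorem val_coarsenSite (n : ℕ) (x : Site (PV d ℓ m (K + n) hd hL) 0) (μ : Fin (d + 1)) :
    ((coarsenSite n x) μ).val = (x μ).val / (ℓ + 1) ^ n := by
  simp only [coarsenSite]
  rw [ZMod.val_natCast, Nat.mod_eq_of_lt]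
  have hx := ZMod.val_lt (x μ)
  have hs : (PV d ℓ m (K + n) hd hL).sitesPerDir 0 = (ℓ + 1) ^ n * (PV d ℓ m K hd hL).sitesPerDir 0 := by
    show 2 * (ℓ + 1) ^ (m + (K + n) - 0) = (ℓ + 1) ^ n * (2 * (ℓ + 1) ^ (m + K - 0))
    simp only [Nat.sub_zero, pow_add]; ring
  exact Nat.div_lt_of_lt_mul (lt_of_lt_of_eq hx hs)

/-- `x′ ↦ x` is the `n`-fold block map followed by the level cast. [cite: King1986, p.664 («x′ ∈ Bⁿ(x)»); Balaban1984PropagatorsI, (1.18) p.20] -/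
theorem coarsenSite_eq_cast_iterBlockOf (n : ℕ) (x : Site (PV d ℓ m (K + n) hd hL) 0) :
    coarsenSite n x = siteCast (show n = 0 + n by omega) (iterBlockOf n x) := by
  apply site_ext
  intro μ
  rw [val_coarsenSite, val_siteCast, val_iterBlockOf (P := PV d ℓ m (K + n) hd hL) n (by show n ≤ m + (K + n); omega)]

/-- **THE CHART OF THE COARSENED SITE IS THE COARSENED CHART POINT**: `toBox (x′ ↦ x) = (toBox⁺ x′) ÷ Lⁿ`. [cite: King1986, p.664; Balaban1984PropagatorsII, (2.1) p.224, dictionary] -/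
theorem toBox_coarsenSite {Mh k : ℕ} {P' : Fin (d + 1) → ℕ} (hN : ∀ μ, N0 ℓ Mh k P' μ = (PV d ℓ m K hd hL).sitesPerDir 0) (n : ℕ)
    (x : Site (PV d ℓ m (K + n) hd hL) 0) : toBox hN (coarsenSite n x) = coarsen n (toBox (hN_refine hN n) x) := by
  apply Subtype.ext
  funext μ
  rw [coarsen_val, toBox_apply, val_coarsenSite, Int.natCast_div, Nat.cast_pow]
  rfl

/-- blocks of the coarsened site are the cast blocks of the fine site: `y^j(x) = cast (y^{j+n}(x′))`. [cite: King1986, p.664; Balaban1984PropagatorsI, (1.18) p.20] -/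
theorem iterBlockOf_coarsenSite {n j : ℕ} (hj : j ≤ m + K) (x : Site (PV d ℓ m (K + n) hd hL) 0) :
    iterBlockOf j (coarsenSite n x) = siteCast rfl (iterBlockOf (j + n) x) := by
  apply site_ext
  intro μ
  rw [val_iterBlockOf (P := PV d ℓ m K hd hL) j (by show j ≤ m + K; omega), val_coarsenSite, val_siteCast,
    val_iterBlockOf (P := PV d ℓ m (K + n) hd hL) (j + n) (by show j + n ≤ m + (K + n); omega), Nat.div_div_eq_div_mul]
  show (x μ).val / ((ℓ + 1) ^ n * (ℓ + 1) ^ j) = (x μ).val / (ℓ + 1) ^ (j + n)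
  rw [pow_add, mul_comm]

/-- every coarse site is a coarsening (lift the labels: `val ↦ Lⁿ·val`). [cite: King1986, p.664 («x′ ∈ Bⁿ(x)»)] -/
theorem coarsenSite_surjective (n : ℕ) : Function.Surjective (coarsenSite (d := d) (ℓ := ℓ) (m := m) (K := K) (hd := hd) (hL := hL) n) := by
  intro y
  refine ⟨fun μ => ((((y μ).val * (ℓ + 1) ^ n : ℕ)) : ZMod ((PV d ℓ m (K + n) hd hL).sitesPerDir 0)), site_ext fun μ => ?_⟩
  have hL1 : 0 < (ℓ + 1) ^ n := by positivity
  have hy := ZMod.val_lt (y μ)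
  have hlt : (y μ).val * (ℓ + 1) ^ n < (PV d ℓ m (K + n) hd hL).sitesPerDir 0 := by
    have hs : (PV d ℓ m (K + n) hd hL).sitesPerDir 0 = (PV d ℓ m K hd hL).sitesPerDir 0 * (ℓ + 1) ^ n := by
      show 2 * (ℓ + 1) ^ (m + (K + n) - 0) = 2 * (ℓ + 1) ^ (m + K - 0) * (ℓ + 1) ^ n
      simp only [Nat.sub_zero, pow_add]; ring
    rw [hs]
    exact Nat.mul_lt_mul_of_pos_right hy hL1
  rw [val_coarsenSite]
  simp only [ZMod.val_natCast, Nat.mod_eq_of_lt hlt, Nat.mul_div_cancel _ hL1]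

end Sites

/-! ## §2  The V1 domain data of the refined family: `Ω⁺_{j+n} = cast⁻¹ Ω_j`, `Λ⁺_{j+n} = cast⁻¹ Λ_j` (bonds), `Λ⁺_i = ∅` (`i ≤ n`); the index-bond bijection -/

section Index

/-- the standing range of the refined family. [cite: Balaban1984PropagatorsII, (2.1) p.224, bookkeeping] -/
theorem hk_refine {k : ℕ} (hk : k ≤ m + K) (n : ℕ) : k + n ≤ m + (K + n) := by omega

variable {Mh k R : ℕ} {P' : Fin (d + 1) → ℕ} (hN : ∀ μ, N0 ℓ Mh k P' μ = (PV d ℓ m K hd hL).sitesPerDir 0)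
  (D : TDomains d ℓ Mh k P' R) (hk : k ≤ m + K) (n : ℕ)

/-- **`Ω⁺_{j+n}^{(j+n)} = cast⁻¹ Ω_j^{(j)}`** at every level (`j = 0`: both the whole torus; `1 ≤ j ≤ k`: the dictionary `Ω_j ↔ {lev ≥ j}` on both sides and
`lev⁺ = lev ∘ (x′ ↦ x) + n`; `j > k`: both empty). [cite: Balaban1984PropagatorsII, (2.1)–(2.4) p.224; King1986, p.664] -/
theorem mem_Om_refine_iff {i j : ℕ} (hi : i = j + n) (y : Site (PV d ℓ m (K + n) hd hL) i) :
    y ∈ (domT (hN_refine hN n) (refineT D n) (hk_refine hk n)).Om i ↔ siteCast hi y ∈ (domT hN D hk).Om j := by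
  subst hi
  rcases Nat.eq_zero_or_pos j with hj0 | hj1
  · subst hj0
    rw [(domT hN D hk).Om_zero]
    simp only [Finset.mem_univ, iff_true]
    rcases Nat.eq_zero_or_pos n with hn0 | hn1
    · subst hn0
      rw [(domT (hN_refine hN 0) (refineT D 0) (hk_refine hk 0)).Om_zero]
      exact Finset.mem_univ _
    · obtain ⟨x, rfl⟩ := exists_iterBlockOf_eq (by show 0 + n ≤ m + (K + n); omega) y
      rw [iterBlockOf_mem_domT_iff (hN_refine hN n) (refineT D n) (hk_refine hk n) (j := 0 + n) (by omega) (by omega), refineT_lev]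
      omega
  · by_cases hjk : j ≤ k
    · obtain ⟨x, rfl⟩ := exists_iterBlockOf_eq (by show j + n ≤ m + (K + n); omega) y
      rw [iterBlockOf_mem_domT_iff (hN_refine hN n) (refineT D n) (hk_refine hk n) (j := j + n) (by omega) (by omega), refineT_lev,
        ← iterBlockOf_coarsenSite (by omega), iterBlockOf_mem_domT_iff hN D hk hj1 hjk, toBox_coarsenSite, coarsen_val]
      omega
    · rw [(domT hN D hk).Om_eq_empty (show (domT hN D hk).k < j from not_le.1 hjk),
        (domT (hN_refine hN n) (refineT D n) (hk_refine hk n)).Om_eq_empty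
          (show (domT (hN_refine hN n) (refineT D n) (hk_refine hk n)).k < j + n by change k + n < j + n; omega)]
      simp

/-- the low levels of the refined datum are the whole torus: `Ω⁺_i = T⁺^{(i)}` for `i ≤ n + 1` (every fine site has `lev⁺ ≥ n + 1`). [cite: Balaban1984PropagatorsII, p.224 («Ω_j = T_η for j = 1, 2, …, l»); King1986, p.664] -/
theorem mem_Om_refine_low {i : ℕ} (hi : i ≤ n + 1) (y : Site (PV d ℓ m (K + n) hd hL) i) :
    y ∈ (domT (hN_refine hN n) (refineT D n) (hk_refine hk n)).Om i := by
  rcases Nat.eq_zero_or_pos i with hi0 | hi1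
  · subst hi0
    rw [(domT (hN_refine hN n) (refineT D n) (hk_refine hk n)).Om_zero]
    exact Finset.mem_univ _
  · have hl := D.one_le_lev
    by_cases hik : i ≤ k + n
    · obtain ⟨x, rfl⟩ := exists_iterBlockOf_eq (by show i ≤ m + (K + n); omega) y
      rw [iterBlockOf_mem_domT_iff (hN_refine hN n) (refineT D n) (hk_refine hk n) hi1 hik, refineT_lev]
      have := hl (blk ((ℓ + 1) ^ n) (toBox (hN_refine hN n) x).1)
      omega
    · -- `k = 0`, `i = n + 1`: both sides degenerate (`Ω_{k+n+1} = ∅` is NOT the whole torus) — excluded: `i ≤ k + n` fails only if `k = 0`,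
      -- and then `lev ≤ k = 0` contradicts `1 ≤ lev`.
      exfalso
      have h1 := D.one_le_lev 0
      have h2 := D.lev_le 0
      omega

/-- **`Deep⁺ ↔ Deep`**: a level-`(j+n)` site of the refined run lies inside `Ω⁺_{j+n+1}` iff its cast lies inside `Ω_{j+1}`. [cite: Balaban1984PropagatorsII, (2.3) p.224; King1986, p.664] -/
theorem deep_refine_iff {i j : ℕ} (hi : i = j + n) (y : Site (PV d ℓ m (K + n) hd hL) i) :
    (domT (hN_refine hN n) (refineT D n) (hk_refine hk n)).Deep i y ↔ (domT hN D hk).Deep j (siteCast hi y) := by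
  unfold B6SectADomainsV1.Domains.Deep
  by_cases hj : j + 1 ≤ m + K
  · rw [mem_Om_refine_iff hN D hk n (show i + 1 = (j + 1) + n by omega), siteCast_blockOf hi hj]
  · -- top level: `Ω_{j+1} = ∅` on both sides (`k ≤ m + K < j + 1`)
    rw [(domT hN D hk).Om_eq_empty (show (domT hN D hk).k < j + 1 by change k < j + 1; omega),
      (domT (hN_refine hN n) (refineT D n) (hk_refine hk n)).Om_eq_empty
        (show (domT (hN_refine hN n) (refineT D n) (hk_refine hk n)).k < i + 1 by change k + n < i + 1; omega)]
    simp

/-- every low-level site of the refined run is deep: `Deep⁺_i` for `i ≤ n`. [cite: Balaban1984PropagatorsII, p.224; King1986, p.664] -/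
theorem deep_refine_low {i : ℕ} (hi : i ≤ n) (y : Site (PV d ℓ m (K + n) hd hL) i) :
    (domT (hN_refine hN n) (refineT D n) (hk_refine hk n)).Deep i y :=
  mem_Om_refine_low hN D hk n (by omega) (blockOf y)

/-- **`Λ⁺_{j+n} = cast⁻¹ Λ_j` ON BONDS**: a level-`(j+n)` bond of the refined run is an index bond iff its cast is. [cite: Balaban1984PropagatorsII, (2.3) p.224 («Λ_j also the set of bonds»); King1986, p.664] -/
theorem lamBond_refine_iff {i j : ℕ} (hi : i = j + n) (b : PBond (PV d ℓ m (K + n) hd hL) i) :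
    (domT (hN_refine hN n) (refineT D n) (hk_refine hk n)).LamBond i b ↔ (domT hN D hk).LamBond j (bondCast hi b) := by
  unfold B6SectADomainsV1.Domains.LamBond
  rw [bondCast_tgt, bondCast_src, mem_Om_refine_iff hN D hk n hi, mem_Om_refine_iff hN D hk n hi, deep_refine_iff hN D hk n hi,
    deep_refine_iff hN D hk n hi]

/-- no index bond of the refined run has level `≤ n`. [cite: Balaban1984PropagatorsII, (2.3) p.224; King1986, p.664] -/
theorem not_lamBond_refine_low {i : ℕ} (hi : i ≤ n) (b : PBond (PV d ℓ m (K + n) hd hL) i) :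
    ¬ (domT (hN_refine hN n) (refineT D n) (hk_refine hk n)).LamBond i b :=
  fun h => h.2.1 (deep_refine_low hN D hk n hi b.src)

/-- the level of an index bond of the refined run exceeds `n`. [cite: Balaban1984PropagatorsII, (2.3) p.224; King1986, p.664] -/
theorem lt_lvl_refine (p : BondIdx (domT (hN_refine hN n) (refineT D n) (hk_refine hk n))) : n < (p.1.1 : ℕ) := by
  by_contra h
  exact not_lamBond_refine_low hN D hk n (not_lt.1 h) p.1.2 p.2

/-- **THE INDEX-BOND EMBEDDING `𝔅 → 𝔅⁺`** (V1 index bonds): `⟨j, b⟩ ↦ ⟨j + n, cast⁻¹ b⟩`. [cite: King1986, p.664 («a site of Λ_j in run A ↦ the site of scale index j + n … in run B»); Balaban1984PropagatorsII, (2.3) p.224] -/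
def idxUp (p : BondIdx (domT hN D hk)) : BondIdx (domT (hN_refine hN n) (refineT D n) (hk_refine hk n)) :=
  ⟨⟨⟨(p.1.1 : ℕ) + n, by have := p.1.1.isLt; change (p.1.1 : ℕ) < k + 1 at this; change (p.1.1 : ℕ) + n < k + n + 1; omega⟩,
      (bondCast (rfl : (p.1.1 : ℕ) + n = (p.1.1 : ℕ) + n)).symm p.1.2⟩,
    (lamBond_refine_iff hN D hk n rfl _).2 (by rw [Equiv.apply_symm_apply]; exact p.2)⟩

/-- the level of the embedded index bond: `j + n`. [cite: King1986, p.664 («scale index j + n»)] -/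
@[simp] theorem idxUp_level (p : BondIdx (domT hN D hk)) : ((idxUp hN D hk n p).1.1 : ℕ) = (p.1.1 : ℕ) + n := rfl

/-- the bond of the embedded index bond: `cast⁻¹ b`. [cite: King1986, p.664, dictionary] -/
theorem idxUp_bond (p : BondIdx (domT hN D hk)) : (idxUp hN D hk n p).1.2 = (bondCast rfl).symm p.1.2 := rfl

/-- `idxUp` is injective. [cite: King1986, p.664, bookkeeping] -/
theorem idxUp_injective : Function.Injective (idxUp hN D hk n) := by
  rintro ⟨⟨⟨j₁, hj₁⟩, b₁⟩, h₁⟩ ⟨⟨⟨j₂, hj₂⟩, b₂⟩, h₂⟩ h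
  have hfst := congrArg (fun q : BondIdx (domT (hN_refine hN n) (refineT D n) (hk_refine hk n)) => (q.1.1 : ℕ)) h
  simp only [idxUp_level] at hfst
  have hj : j₁ = j₂ := by omega
  subst hj
  have hsnd := congrArg (fun q : BondIdx (domT (hN_refine hN n) (refineT D n) (hk_refine hk n)) => q.1) h
  simp only [idxUp] at hsnd
  have hb := eq_of_heq (Sigma.mk.inj hsnd).2
  have hb' : b₁ = b₂ := (bondCast rfl).symm.injective hb
  subst hb'
  rfl

/-- `idxUp` is surjective (every index bond of the refined run has level `> n`). [cite: King1986, p.664, bookkeeping] -/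
theorem idxUp_surjective : Function.Surjective (idxUp hN D hk n) := by
  rintro ⟨⟨⟨i, hi⟩, b⟩, h⟩
  have hn : n < i := lt_lvl_refine hN D hk n ⟨⟨⟨i, hi⟩, b⟩, h⟩
  obtain ⟨j, rfl⟩ : ∃ j, i = j + n := ⟨i - n, by omega⟩
  have hjk : j < k + 1 := by change j + n < k + n + 1 at hi; omega
  refine ⟨⟨⟨⟨j, hjk⟩, bondCast rfl b⟩, (lamBond_refine_iff hN D hk n rfl b).1 h⟩, ?_⟩
  apply Subtype.ext
  simp only [idxUp]
  rw [Equiv.symm_apply_apply]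

/-- **THE INDEX SETS CORRESPOND**: `𝔅(D) ≃ 𝔅(D⁺)` (V1 index bonds). [cite: King1986, p.664; Balaban1984PropagatorsII, (2.3) p.224, (2.20) p.226 (𝔅)] -/
def idxEquiv : BondIdx (domT hN D hk) ≃ BondIdx (domT (hN_refine hN n) (refineT D n) (hk_refine hk n)) :=
  Equiv.ofBijective (idxUp hN D hk n) ⟨idxUp_injective hN D hk n, idxUp_surjective hN D hk n⟩

/-- the bijection is `idxUp`. [cite: King1986, p.664, dictionary] -/
@[simp] theorem idxEquiv_apply (p : BondIdx (domT hN D hk)) : idxEquiv hN D hk n p = idxUp hN D hk n p := rfl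

/-- `idxEquiv⁻¹ (idxUp p) = p`. [cite: King1986, p.664, dictionary] -/
@[simp] theorem idxEquiv_symm_idxUp (p : BondIdx (domT hN D hk)) : (idxEquiv hN D hk n).symm (idxUp hN D hk n p) = p :=
  (idxEquiv hN D hk n).symm_apply_apply p

/-- **THE TRANSPORTED WEIGHTS** `w⁺(ι b) := L^{n(d+1)}·w(b)` — the SAME physical weight `a_j(Lʲη)^{d−2}` of (2.14)∕(2.20) read in the refined units
`c_f⁺ = Lⁿc_f` (the flat `w` of `B6SectAVectorModelV1.deltaAE` carries `a_j·(Lʲ)^{d+1}·c_f²`-normalised weights, `GlobalBand`). [cite: Balaban1984PropagatorsII, (2.14) p.225, (2.20) p.226; King1986, p.664] -/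
def wRefine (w : BondIdx (domT hN D hk) → ℝ) : BondIdx (domT (hN_refine hN n) (refineT D n) (hk_refine hk n)) → ℝ :=
  fun p => ((((ℓ + 1 : ℕ) : ℝ)) ^ n) ^ (d + 1) * w ((idxEquiv hN D hk n).symm p)

/-- the transported weight at an embedded bond. [cite: Balaban1984PropagatorsII, (2.14) p.225; King1986, p.664] -/
@[simp] theorem wRefine_idxUp (w : BondIdx (domT hN D hk) → ℝ) (p : BondIdx (domT hN D hk)) :
    wRefine hN D hk n w (idxUp hN D hk n p) = ((((ℓ + 1 : ℕ) : ℝ)) ^ n) ^ (d + 1) * w p := by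
  simp only [wRefine, idxEquiv_symm_idxUp]

/-- positivity transports. [cite: Balaban1984PropagatorsII, (2.14) p.225, bookkeeping] -/
theorem wRefine_pos {w : BondIdx (domT hN D hk) → ℝ} (hw : ∀ p, 0 < w p) (p) : 0 < wRefine hN D hk n w p := by
  unfold wRefine
  exact mul_pos (by positivity) (hw _)

/-- **THE BAND (2.14) TRANSPORTS WITH THE SAME CONSTANTS**: `w⁺/(c_f⁺/L^{j+n})² = L^{n(d+1)}·w/(c_f/L^j)² ∈ [b₀, b₁]·(L^{j+n})^{d+1}`. [cite: Balaban1984PropagatorsII, (2.14) p.225; King1986, p.664] -/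
theorem globalBand_refine {b₀ b₁ cf : ℝ} {w : BondIdx (domT hN D hk) → ℝ} (hwb : GlobalBand b₀ b₁ cf w) :
    GlobalBand b₀ b₁ ((((ℓ + 1 : ℕ) : ℝ)) ^ n * cf) (wRefine hN D hk n w) := by
  intro p'
  obtain ⟨p, rfl⟩ := idxUp_surjective hN D hk n p'
  obtain ⟨h1, h2⟩ := hwb p
  rw [wRefine_idxUp, idxUp_level]
  have hL : (0 : ℝ) < ((ℓ + 1 : ℕ) : ℝ) := by positivity
  set L : ℝ := ((ℓ + 1 : ℕ) : ℝ) with hLdef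
  set j : ℕ := (p.1.1 : ℕ)
  have hLj : (0 : ℝ) < L ^ j := pow_pos hL j
  have hLn : (0 : ℝ) < L ^ n := pow_pos hL n
  have key : (L ^ n) ^ (d + 1) * w p / (L ^ n * cf / L ^ (j + n)) ^ 2 = (L ^ n) ^ (d + 1) * (w p / (cf / L ^ j) ^ 2) := by
    have e1 : L ^ n * cf / L ^ (j + n) = cf / L ^ j := by
      rw [pow_add L j n, mul_comm (L ^ j) (L ^ n), mul_div_mul_left _ _ hLn.ne']
    rw [e1, mul_div_assoc]
  rw [key, pow_add L j n, mul_pow]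
  constructor
  · calc b₀ * ((L ^ j) ^ (d + 1) * (L ^ n) ^ (d + 1)) = (L ^ n) ^ (d + 1) * (b₀ * (L ^ j) ^ (d + 1)) := by ring
      _ ≤ (L ^ n) ^ (d + 1) * (w p / (cf / L ^ j) ^ 2) := mul_le_mul_of_nonneg_left h1 (by positivity)
  · calc (L ^ n) ^ (d + 1) * (w p / (cf / L ^ j) ^ 2) ≤ (L ^ n) ^ (d + 1) * (b₁ * (L ^ j) ^ (d + 1)) :=
          mul_le_mul_of_nonneg_left h2 (by positivity)
      _ = b₁ * ((L ^ j) ^ (d + 1) * (L ^ n) ^ (d + 1)) := by ring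

end Index

/-! ## §3  The refined member: `refineK : KIdx → KIdx`, `refineY : MemberY → MemberY` -/

section Member

variable {b₀ b₁ : ℝ} {Mstar : ℕ}

/-- **THE n-FOLD REFINEMENT OF A k-LEVEL V1 INDEX** («run B at η′ = L^{−n}η»): cut-off `K ↦ K + n` (the torus `T_{η′}`, `Lⁿ` times finer, same physical
size `2L^m`), `k ↦ k + n` levels, the nested sequence refined block-wise with `n` trivial bottom levels (`refineT`), `c_f ↦ Lⁿ·c_f`, the (2.14)-banded weights
transported through `𝔅 ≃ 𝔅⁺` (`wRefine`, same band constants); `m, M_h, R, a, P′` kept. [cite: King1986, p.664 (runs A at η and B at η′ = L^{−n}η, k + n scales); Balaban1984PropagatorsII, (2.1)–(2.4) p.224, (2.14) p.225] -/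
def refineK (i : KIdx d ℓ hd hL b₀ b₁) (n : ℕ) : KIdx d ℓ hd hL b₀ b₁ where
  m := i.m
  K := i.K + n
  Mh := i.Mh
  k := i.k + n
  R := i.R
  a := i.a
  P' := i.P'
  hN := hN_refine i.hN n
  D := refineT i.D n
  hk := hk_refine i.hk n
  hk2 := by have := i.hk2; omega
  hMha := i.hMha
  hM8 := i.hM8
  hR2 := i.hR2
  hP5 := i.hP5
  hℓ := i.hℓ
  hpl := placed_refineT i.D n i.hpl
  cf := (((ℓ + 1 : ℕ) : ℝ)) ^ n * i.cf
  hcf := mul_ne_zero (pow_ne_zero _ (by positivity)) i.hcf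
  w := wRefine i.hN i.D i.hk n i.w
  hw := wRefine_pos i.hN i.D i.hk n i.hw
  hwb := globalBand_refine i.hN i.D i.hk n i.hwb

/-- field-by-field description of the refined index. [cite: King1986, p.664, dictionary] -/
@[simp] theorem refineK_m (i : KIdx d ℓ hd hL b₀ b₁) (n : ℕ) : (refineK i n).m = i.m := rfl
/-- field-by-field description of the refined index. [cite: King1986, p.664, dictionary] -/
@[simp] theorem refineK_K (i : KIdx d ℓ hd hL b₀ b₁) (n : ℕ) : (refineK i n).K = i.K + n := rfl
/-- field-by-field description of the refined index. [cite: King1986, p.664, dictionary] -/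
@[simp] theorem refineK_Mh (i : KIdx d ℓ hd hL b₀ b₁) (n : ℕ) : (refineK i n).Mh = i.Mh := rfl
/-- field-by-field description of the refined index. [cite: King1986, p.664 («k + n scales»), dictionary] -/
@[simp] theorem refineK_k (i : KIdx d ℓ hd hL b₀ b₁) (n : ℕ) : (refineK i n).k = i.k + n := rfl
/-- field-by-field description of the refined index. [cite: King1986, p.664, dictionary] -/
@[simp] theorem refineK_R (i : KIdx d ℓ hd hL b₀ b₁) (n : ℕ) : (refineK i n).R = i.R := rfl
/-- field-by-field description of the refined index. [cite: King1986, p.664, dictionary] -/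
@[simp] theorem refineK_P' (i : KIdx d ℓ hd hL b₀ b₁) (n : ℕ) : (refineK i n).P' = i.P' := rfl
/-- field-by-field description of the refined index. [cite: King1986, p.664, dictionary] -/
@[simp] theorem refineK_D (i : KIdx d ℓ hd hL b₀ b₁) (n : ℕ) : (refineK i n).D = refineT i.D n := rfl
/-- field-by-field description of the refined index: `c_f⁺ = Lⁿ·c_f` (`η⁺ = L^{−n}η`). [cite: King1986, p.664 («η′ = L^{−n}η»), dictionary] -/
@[simp] theorem refineK_cf (i : KIdx d ℓ hd hL b₀ b₁) (n : ℕ) : (refineK i n).cf = (((ℓ + 1 : ℕ) : ℝ)) ^ n * i.cf := rfl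
/-- field-by-field description of the refined index. [cite: Balaban1984PropagatorsII, (2.14) p.225; King1986, p.664, dictionary] -/
theorem refineK_w (i : KIdx d ℓ hd hL b₀ b₁) (n : ℕ) : (refineK i n).w = wRefine i.hN i.D i.hk n i.w := rfl
/-- no refinement is the identity on the level count. [cite: King1986, p.664, bookkeeping] -/
theorem refineK_zero_k (i : KIdx d ℓ hd hL b₀ b₁) : (refineK i 0).k = i.k := rfl

/-- **THE n-FOLD REFINEMENT `x ↦ x⁺` OF A MEMBER OF THE [B9] FAMILY INDEX** (Stage 3′(Y)): the refined `KIdx` (still at print's units, `c_f⁺ = Lⁿ·Lᵏ = L^{k+n}`,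
same floor `M⋆ ≤ L·M_h`), the second sequence `{Ω′_j}` refined the same way with its accessories, and the Sect.-E datum pulled back along `x′ ↦ x`:
`Λ⁺ := {x′ | x ∈ Λ}` — a union of big `(k+n)`-blocks of level `k + n` whose torus distance to the lower levels exceeds `R·M·L^{k+n}` FINE⁺ units (the same
physical distance). [cite: King1986, p.664 (convention before Prop. 3.8); Balaban1985BackgroundPropagators, p.399 (the family), Thm 3.14 pp.426–427, Thm 3.15 (3.185)–(3.187) p.432] -/
def refineY (x : MemberY d ℓ hd hL b₀ b₁ Mstar) (n : ℕ) : MemberY d ℓ hd hL b₀ b₁ Mstar where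
  toKIdx := refineK x.toKIdx n
  hcfk := by
    show (((ℓ + 1 : ℕ) : ℝ)) ^ n * x.cf = (((ℓ + 1 : ℕ) : ℝ)) ^ (x.k + n)
    rw [x.hcfk, pow_add, mul_comm]
  hMstar := x.hMstar
  D' := refineT x.D' n
  hpl' := placed_refineT x.D' n x.hpl'
  w' := wRefine x.hN x.D' x.hk n x.w'
  hw' := wRefine_pos x.hN x.D' x.hk n x.hw'
  hwb' := globalBand_refine x.hN x.D' x.hk n x.hwb'
  Λ := {x' : Site (PV d ℓ x.m (x.K + n) hd hL) 0 | coarsenSite n x' ∈ x.Λ}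
  hΛlev := fun (x' : Site (PV d ℓ x.m (x.K + n) hd hL) 0) (hx' : coarsenSite n x' ∈ x.Λ) => by
    show (refineT x.D n).lev (toBox (hN_refine x.hN n) x').1 = x.k + n
    rw [refineT_lev, ← coarsen_val, ← toBox_coarsenSite x.hN n x', x.hΛlev _ hx']
  hΛblocks := fun (x₁ x₂ : Site (PV d ℓ x.m (x.K + n) hd hL) 0)
      (h : blk (bigSide ℓ x.Mh (x.k + n)) (toBox (hN_refine x.hN n) x₂).1 = blk (bigSide ℓ x.Mh (x.k + n)) (toBox (hN_refine x.hN n) x₁).1) => by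
    show coarsenSite n x₁ ∈ x.Λ ↔ coarsenSite n x₂ ∈ x.Λ
    apply x.hΛblocks
    rw [toBox_coarsenSite x.hN n x₁, toBox_coarsenSite x.hN n x₂, coarsen_val, coarsen_val, blk_blk, blk_blk, ← bigSide_add]
    exact h
  hΛsep := fun (x₁ : Site (PV d ℓ x.m (x.K + n) hd hL) 0) (hx₁ : coarsenSite n x₁ ∈ x.Λ) (x₂ : Site (PV d ℓ x.m (x.K + n) hd hL) 0)
      (hlt : (refineT x.D n).lev (toBox (hN_refine x.hN n) x₂).1 < x.k + n) => by
    show ((x.R * bigSide ℓ x.Mh (x.k + n) : ℕ) : ℝ) <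
      torusSupNorm (N0 ℓ x.Mh (x.k + n) x.P') ((toBox (hN_refine x.hN n) x₁).1 - (toBox (hN_refine x.hN n) x₂).1)
    rw [refineT_lev, ← coarsen_val, ← toBox_coarsenSite x.hN n x₂] at hlt
    have h := x.hΛsep _ hx₁ (coarsenSite n x₂) (by omega)
    rw [toBox_coarsenSite x.hN n x₁, toBox_coarsenSite x.hN n x₂, coarsen_val, coarsen_val] at h
    exact sep_of_coarsen (fun i => one_le_of_mem (toBox x.hN (coarsenSite n x₁)).2 i) n x.R x.k _ _ h

/-- the refined member's index is the refined index. [cite: King1986, p.664, dictionary] -/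
@[simp] theorem refineY_toKIdx (x : MemberY d ℓ hd hL b₀ b₁ Mstar) (n : ℕ) : (refineY x n).toKIdx = refineK x.toKIdx n := rfl
/-- the refined second sequence. [cite: Balaban1985BackgroundPropagators, Thm 3.14 pp.426–427; King1986, p.664, dictionary] -/
@[simp] theorem refineY_D' (x : MemberY d ℓ hd hL b₀ b₁ Mstar) (n : ℕ) : (refineY x n).D' = refineT x.D' n := rfl
/-- **`Λ⁺ = (x′ ↦ x)⁻¹ Λ`**. [cite: King1986, p.664; Balaban1985BackgroundPropagators, Thm 3.15 p.432, dictionary] -/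
theorem mem_Λ_refineY (x : MemberY d ℓ hd hL b₀ b₁ Mstar) (n : ℕ) (x' : Site (PV d ℓ x.m (x.K + n) hd hL) 0) :
    x' ∈ (refineY x n).Λ ↔ coarsenSite n x' ∈ x.Λ := Iff.rfl

end Member

/-! ## §4  The site embedding `ιY` of the geometries of record and the type-level fields of the η-pairing -/

section Pairing

variable {b₀ b₁ : ℝ} {Mstar : ℕ}

section Beta

variable {Mh k R : ℕ} {P' : Fin (d + 1) → ℕ} (hN : ∀ μ, N0 ℓ Mh k P' μ = (PV d ℓ m K hd hL).sitesPerDir 0)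
  (D : TDomains d ℓ Mh k P' R) (hk : k ≤ m + K) (n : ℕ)

/-- the base end-point of the embedded index bond is the (inverse-cast) base end-point. [cite: Balaban1984PropagatorsII, (2.3) p.224; King1986, p.664] -/
theorem cast_base_idxUp (c : BondIdx (domT hN D hk)) :
    siteCast rfl (base (hN_refine hN n) (refineT D n) (hk_refine hk n) (idxUp hN D hk n c)) = base hN D hk c := by
  unfold base
  have hsrc : (idxUp hN D hk n c).1.2.src = (siteCast (rfl : lvl hN D hk c + n = lvl hN D hk c + n)).symm c.1.2.src := rfl
  have hcond : (idxUp hN D hk n c).1.2.src ∈ (domT (hN_refine hN n) (refineT D n) (hk_refine hk n)).Om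
      (lvl (hN_refine hN n) (refineT D n) (hk_refine hk n) (idxUp hN D hk n c)) ↔ c.1.2.src ∈ (domT hN D hk).Om (lvl hN D hk c) := by
    have h := mem_Om_refine_iff hN D hk n (rfl : lvl hN D hk c + n = lvl hN D hk c + n) ((siteCast rfl).symm c.1.2.src)
    rw [Equiv.apply_symm_apply] at h
    exact h
  by_cases h : c.1.2.src ∈ (domT hN D hk).Om (lvl hN D hk c)
  · rw [if_pos (hcond.2 h), if_pos h, hsrc, Equiv.apply_symm_apply]
  · rw [if_neg (fun h' => h (hcond.1 h')), if_neg h]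
    have ht := bondCast_tgt (rfl : lvl hN D hk c + n = lvl hN D hk c + n) ((bondCast rfl).symm c.1.2)
    rw [Equiv.apply_symm_apply] at ht
    exact ht.symm

/-- **THE CARRIER BLOCK OF THE EMBEDDED BOND IS THE EMBEDDED CARRIER BLOCK**: `β⁺(ι c) = ι_𝔅(β c)`. [cite: Balaban1984PropagatorsII, (2.45) p.231; King1986, p.664] -/
theorem beta_idxUp (hk1 : 1 ≤ k) (c : BondIdx (domT hN D hk)) :
    β (hN_refine hN n) (refineT D n) (hk_refine hk n) (idxUp hN D hk n c) = ιB D n (β hN D hk c) := by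
  set x' := baseSite (hN_refine hN n) (refineT D n) (hk_refine hk n) (idxUp hN D hk n c) with hx'
  have hbase := iterBlockOf_baseSite (hN_refine hN n) (refineT D n) (hk_refine hk n) (idxUp hN D hk n c)
  have hx : iterBlockOf (lvl hN D hk c) (coarsenSite n x') = base hN D hk c := by
    rw [iterBlockOf_coarsenSite (B6Ineq2142KLevelV1.lvl_le_mK hN D hk c), ← cast_base_idxUp hN D hk n c]
    exact congrArg _ hbase
  show blkOf (refineT D n).toDomains (toBox (hN_refine hN n) x') = ιB D n (β hN D hk c)
  rw [blkOf_refine, ← toBox_coarsenSite hN n x', blkOf_eq_beta hN D hk hk1 c hx]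

end Beta

variable (x : MemberY d ℓ hd hL b₀ b₁ Mstar) (n : ℕ)

/-- **THE SITE EMBEDDING `ι : (geo9Y x).Site → (geo9Y x⁺).Site`** of the geometries of record (sites = index bonds): `⟨j, b⟩ ↦ ⟨j + n, cast⁻¹ b⟩` — «a site of
Λ_j in run A ↦ the site of scale index j + n and the same physical size in run B». [cite: King1986, p.664 (convention before Prop. 3.8); Balaban1985BackgroundPropagators, (3.39)–(3.41) p.397] -/
def ιY : (geo9Y x).Site → (geo9Y (refineY x n)).Site := idxUp x.hN x.D x.hk n

/-- `ι` is the index-bond embedding. [cite: King1986, p.664, dictionary] -/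
theorem ιY_apply (c : (geo9Y x).Site) : ιY x n c = idxUp x.hN x.D x.hk n c := rfl

/-- `ι` is a bijection of the site types. [cite: King1986, p.664, bookkeeping] -/
theorem ιY_bijective : Function.Bijective (ιY x n) := ⟨idxUp_injective x.hN x.D x.hk n, idxUp_surjective x.hN x.D x.hk n⟩

/-- **`scale (ι c) = scale c + n`**. [cite: King1986, p.664 («scale index j + n»)] -/
theorem scale_ιY (c : (geo9Y x).Site) : (geo9Y (refineY x n)).scale (ιY x n c) = (geo9Y x).scale c + n := rfl

/-- **`dist (ι c) (ι c′) = dist c c′` — AN EQUALITY** (the torus distance of the carrier blocks in the (2.46) graph is invariant under refinement,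
`Node00.MemberYRefineDomains.geomT_refine_dist`). [cite: Balaban1984PropagatorsII, (2.46) p.231; King1986, p.664 («preserving the scaled distance d(y, y′)»)] -/
theorem dist_ιY (c c' : (geo9Y x).Site) : (geo9Y (refineY x n)).dist (ιY x n c) (ιY x n c') = (geo9Y x).dist c c' := by
  have hk1 : 1 ≤ x.k := le_trans (by norm_num) x.hk2
  show (geomT (refineT x.D n)).dist (β (hN_refine x.hN n) (refineT x.D n) (hk_refine x.hk n) (idxUp x.hN x.D x.hk n c))
      (β (hN_refine x.hN n) (refineT x.D n) (hk_refine x.hk n) (idxUp x.hN x.D x.hk n c')) = (geomT x.D).dist (β x.hN x.D x.hk c) (β x.hN x.D x.hk c')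
  rw [beta_idxUp x.hN x.D x.hk n hk1, beta_idxUp x.hN x.D x.hk n hk1, geomT_refine_dist]

/-- `k⁺ = k + n`. [cite: King1986, p.664 («k + n scales»)] -/
theorem k_refineY : (geo9Y (refineY x n)).k = (geo9Y x).k + n := rfl

/-- `L⁺ = L`. [cite: King1986, p.664, bookkeeping] -/
theorem L_refineY : (geo9Y (refineY x n)).L = (geo9Y x).L := rfl

/-- `M⁺ = M` (`= L·M_h`). [cite: Balaban1985BackgroundPropagators, p.399; King1986, p.664, bookkeeping] -/
theorem M_refineY : (geo9Y (refineY x n)).M = (geo9Y x).M := rfl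

/-- **`η⁺·Lⁿ = η`** (`η = |c_f|⁻¹`, `c_f⁺ = Lⁿc_f`). [cite: King1986, p.664 («η′ = L^{−n}η»)] -/
theorem eta_refineY : (geo9Y (refineY x n)).eta * (geo9Y (refineY x n)).L ^ n = (geo9Y x).eta := by
  show |(((ℓ + 1 : ℕ) : ℝ)) ^ n * x.cf|⁻¹ * (((ℓ + 1 : ℕ) : ℝ)) ^ n = |x.cf|⁻¹
  have hL : (0 : ℝ) < (((ℓ + 1 : ℕ) : ℝ)) ^ n := by positivity
  rw [abs_mul, abs_of_pos hL, mul_inv, mul_assoc, mul_comm (|x.cf|⁻¹), ← mul_assoc, inv_mul_cancel₀ hL.ne', one_mul]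

/-- the embedded site has the same physical size: `L^{j+n}η⁺ = Lʲη`. [cite: King1986, p.664 («the same physical size»)] -/
theorem len_ιY (c : (geo9Y x).Site) : (geo9Y (refineY x n)).len (ιY x n c) = (geo9Y x).len c := by
  unfold B9.Geometry.len
  rw [scale_ιY, pow_add, ← eta_refineY x n, L_refineY]
  ring

end Pairing

/-! ## §5  The pullback of test functions along `x′ ↦ x` — a CANDIDATE `τ` («f′(x′) := f(x)», [K]'s convention read on functions) -/

section Pullback

variable {b₀ b₁ : ℝ} {Mstar : ℕ}

section Blk

variable {Mh k R : ℕ} {P' : Fin (d + 1) → ℕ} (hN : ∀ μ, N0 ℓ Mh k P' μ = (PV d ℓ m K hd hL).sitesPerDir 0)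
  (D : TDomains d ℓ Mh k P' R) (n : ℕ)

/-- the coarsened fine bond `⟨x′, μ⟩ ↦ ⟨x, μ⟩`. [cite: King1986, p.664 (convention before Prop. 3.8), dictionary] -/
def bondCoarsen (b : PBond (PV d ℓ m (K + n) hd hL) 0) : PBond (PV d ℓ m K hd hL) 0 := ⟨coarsenSite n b.src, b.dir⟩

/-- the source of the coarsened bond. [cite: King1986, p.664, dictionary] -/
@[simp] theorem bondCoarsen_src (b : PBond (PV d ℓ m (K + n) hd hL) 0) : (bondCoarsen n b).src = coarsenSite n b.src := rfl

/-- **THE GLOBAL BLOCK OF A FINE⁺ BOND IS THE EMBEDDED BLOCK OF ITS COARSENING**: `y⁺(b′) = ιB(y(b))`. [cite: Balaban1984PropagatorsII, (2.45) p.231 («x ∈ B^j(y)»); King1986, p.664] -/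
theorem blkV1_refine (b : PBond (PV d ℓ m (K + n) hd hL) 0) :
    B6GlobalChartV1.blkV1 (hN_refine hN n) (refineT D n) b = ιB D n (B6GlobalChartV1.blkV1 hN D (bondCoarsen n b)) := by
  unfold B6GlobalChartV1.blkV1
  rw [blkOf_refine, ← toBox_coarsenSite hN n b.src]
  rfl

end Blk

variable (x : MemberY d ℓ hd hL b₀ b₁ Mstar) (n : ℕ)

/-- **THE PULLBACK OF ARGUMENTS ALONG `x′ ↦ x`** (a CANDIDATE test-function transport `τ : (geo9Y x).Loc → (geo9Y x⁺).Loc` — [K]'s site convention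
read on functions, «λ′(x′) := λ(x)», piecewise constant on the `n`-blocks): torus-site functions are pulled back along MODULE A's `coarsen n`, fine-bond
functions along `bondCoarsen n`.  Whether this is THE `τ` of the consumers' `pairingOfRecord₁₁` is the consumers' decision (the η-rate estimate it serves
is not printed); this file records only that it satisfies the two bookkeeping axioms of `T4EtaRate.EtaPairing` (`suppIn_τPull`, `supNorm_τPull_le`).
[cite: King1986, p.664 (convention before Prop. 3.8); Balaban1985BackgroundPropagators, (3.39)–(3.41) p.397 (the arguments λ, J)] -/
def τPull : (geo9Y x).Loc → (geo9Y (refineY x n)).Loc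
  | Sum.inl f => Sum.inl (fun z => f (coarsen n z))
  | Sum.inr J => Sum.inr (fun b => J (bondCoarsen n b))

/-- the pullback of a torus-site function. [cite: King1986, p.664, dictionary] -/
theorem τPull_inl (f : ↥(boxDom (N0 ℓ x.Mh x.k x.P')) → ℝ) : τPull x n (Sum.inl f) = Sum.inl (fun z => f (coarsen n z)) := rfl

/-- the pullback of a fine-bond function. [cite: King1986, p.664, dictionary] -/
theorem τPull_inr (J : PBond (PV d ℓ x.m x.K hd hL) 0 → ℝ) : τPull x n (Sum.inr J) = Sum.inr (fun b => J (bondCoarsen n b)) := rfl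

/-- **SUPPORT COMPATIBILITY**: `supp λ ⊂ Δ(y) ⟹ supp τλ ⊂ Δ⁺(ι y)` (the same physical block, one chart deeper). [cite: King1986, p.664; Balaban1985BackgroundPropagators, p.397 («supp λ ⊂ Δ(y)»)] -/
theorem suppIn_τPull (lam : (geo9Y x).Loc) (c : (geo9Y x).Site) (h : (geo9Y x).suppIn lam c) :
    (geo9Y (refineY x n)).suppIn (τPull x n lam) (ιY x n c) := by
  have hk1 : 1 ≤ x.k := le_trans (by norm_num) x.hk2
  cases lam with
  | inl f =>
    intro z hz
    show blkOf (refineT x.D n).toDomains z = β (hN_refine x.hN n) (refineT x.D n) (hk_refine x.hk n) (idxUp x.hN x.D x.hk n c)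
    rw [beta_idxUp x.hN x.D x.hk n hk1, blkOf_refine]
    exact congrArg _ (h (coarsen n z) hz)
  | inr J =>
    intro b hb
    show B6GlobalChartV1.blkV1 (hN_refine x.hN n) (refineT x.D n) b =
      β (hN_refine x.hN n) (refineT x.D n) (hk_refine x.hk n) (idxUp x.hN x.D x.hk n c)
    rw [beta_idxUp x.hN x.D x.hk n hk1, blkV1_refine x.hN x.D n b]
    exact congrArg _ (h (bondCoarsen n b) hb)

/-- **SUP-NORM COMPATIBILITY**: `|τλ| ≤ |λ|` (an equality, by surjectivity of `x′ ↦ x`; the inequality is the pairing's axiom). [cite: King1986, p.664; Balaban1985BackgroundPropagators, (3.39) p.397 (|λ|)] -/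
theorem supNorm_τPull_le (lam : (geo9Y x).Loc) : (geo9Y (refineY x n)).supNorm (τPull x n lam) ≤ (geo9Y x).supNorm lam := by
  cases lam with
  | inl f =>
    show (⨆ z : ↥(boxDom (N0 ℓ x.Mh (x.k + n) x.P')), |f (coarsen n z)|) ≤ ⨆ z : ↥(boxDom (N0 ℓ x.Mh x.k x.P')), |f z|
    haveI : Nonempty ↥(boxDom (N0 ℓ x.Mh (x.k + n) x.P')) := ⟨(toKT (refineK x.toKIdx n)).origin⟩
    exact ciSup_le fun z => le_ciSup (Finite.bddAbove_range fun z : ↥(boxDom (N0 ℓ x.Mh x.k x.P')) => |f z|) (coarsen n z)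
  | inr J =>
    show (⨆ b : PBond (PV d ℓ x.m (x.K + n) hd hL) 0, |J (bondCoarsen n b)|) ≤ ⨆ b : PBond (PV d ℓ x.m x.K hd hL) 0, |J b|
    haveI : Nonempty (PBond (PV d ℓ x.m (x.K + n) hd hL) 0) := ⟨⟨fun _ => 0, ⟨0, Nat.succ_pos d⟩⟩⟩
    exact ciSup_le fun b => le_ciSup (Finite.bddAbove_range fun b : PBond (PV d ℓ x.m x.K hd hL) 0 => |J b|) (bondCoarsen n b)

end Pullback

end

end Literature.MathematicalPhysics.QuantumFieldTheory.Balaban1983to89.Node00.MemberYRefine
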